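import Summits.AtomisticToContinuum.Crystallization.Theorems.PricedLinkCensusTruncatedCensusGapHarmonicTorusEmbedding

/-!
# Crux `PricedLinkCensus.TruncatedCensusGap` (stmt-AtomisticToContinuum-14230), line `near-far-split`,
# stub N2 `stub_harmonicCoercivityWindow`: the `ℤᵏ → (ℤ/L)ᵏ` torus and the layer telescope

Two bookkeeping pieces closing the generic part of N2's certified core:

* `latticeForm_nonneg_of_zmodSymbol` — specialisation of `latticeForm_nonneg_of_torusSymbol` to
  `A = ℤᵏ` (`Fin k → ℤ`) and the discrete torus `G = (ℤ/L)ᵏ` with the componentwise reduction: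
  if the supports fit in a box of side `< L` (`|x_l - y_l - d_l| < L`), no bond wraps around, so a
  finite-range block-convolution form on a finitely supported field is `≥ 0` as soon as its symbols
  `Σ_{d ∈ R} ψ(d mod L) K d` are positive at every character `ψ` of `(ℤ/L)ᵏ` — these are the
  Bloch / LMI matrices of N2 at the frequencies `ξ ∈ L⁻¹ℤᵏ`;
* `sum_nonneg_of_telescope` — the layer telescope of the transfer certificate: if
  `0 ≤ T m + (B (m+1) - B m)` for `m < n` and `B 0 = B n = 0`, then `0 ≤ Σ_{m<n} T m`.

All `[folklore]`, `def`-free.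
-/

noncomputable section

namespace Summit.AtomisticToContinuum.Crystallization.Theorems.PricedLinkCensusTruncatedCensusGap

open scoped BigOperators
open Finset

/-- **No wrap-around in a large discrete torus**: if `|x_l - y_l - d_l| < L` for all `l`, then
`x - y ≡ d` componentwise modulo `L` forces `x - y = d`. [folklore] -/
theorem sub_eq_of_castZMod_eq {k L : ℕ} {x y d : Fin k → ℤ} (hbox : ∀ l, |x l - y l - d l| < L)
    (h : (fun l => ((x l - y l : ℤ) : ZMod L)) = fun l => ((d l : ℤ) : ZMod L)) : x - y = d := by
  funext l
  have hl : ((x l - y l : ℤ) : ZMod L) = ((d l : ℤ) : ZMod L) := congrFun h l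
  have h0 : ((x l - y l - d l : ℤ) : ZMod L) = 0 := by
    rw [Int.cast_sub (x l - y l), hl, sub_self]
  rw [ZMod.intCast_zmod_eq_zero_iff_dvd] at h0
  have := Int.eq_zero_of_abs_lt_dvd h0 (hbox l)
  rw [Pi.sub_apply]
  linarith

/-- **Lattice form ≥ 0 from `(ℤ/L)ᵏ`-symbols.**  For a block kernel `K : ℤᵏ → ℝ^{ι×ι}` supported
in `R`, a field `u` used on `S`, and `L` with `|x_l - y_l - d_l| < L` (`x, y ∈ S`, `d ∈ R`): if
`Re vᴴ (Σ_{d ∈ R} ψ(d mod L) K d) v ≥ 0` for every character `ψ` of `(ℤ/L)ᵏ` and every complex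
`v`, then `Σ_{x,y ∈ S} u(x)ᵀ K(x - y) u(y) ≥ 0`. [folklore] -/
theorem latticeForm_nonneg_of_zmodSymbol :
    ∀ {ι : Type} [Fintype ι] (k L : ℕ) [NeZero L] (S R : Finset (Fin k → ℤ)) (u : (Fin k → ℤ) → ι → ℝ) (K : (Fin k → ℤ) → Matrix ι ι ℝ), (∀ d, d ∉ R → K d = 0) → (∀ x ∈ S, ∀ y ∈ S, ∀ d ∈ R, ∀ l, |x l - y l - d l| < L) → (∀ (ψ : AddChar (Fin k → ZMod L) ℂ) (v : ι → ℂ), 0 ≤ (star v ⬝ᵥ (∑ d ∈ R, ψ (fun l => ((d l : ℤ) : ZMod L)) • (K d).map ((↑) : ℝ → ℂ)).mulVec v).re) → 0 ≤ ∑ x ∈ S, ∑ y ∈ S, u x ⬝ᵥ (K (x - y)).mulVec (u y) := by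
  intro ι _ k L _ S R u K hK hbox hpos
  set π : (Fin k → ℤ) →+ (Fin k → ZMod L) := (Int.castAddHom (ZMod L)).compLeft (Fin k) with hπ
  have hπapp : ∀ z : Fin k → ℤ, π z = fun l => ((z l : ℤ) : ZMod L) := fun z => rfl
  refine latticeForm_nonneg_of_torusSymbol π S R u K hK ?_ ?_
  · intro x hx y hy d hd hxy
    rw [hπapp, hπapp] at hxy
    exact sub_eq_of_castZMod_eq (hbox x hx y hy d hd) (by simpa [Pi.sub_apply] using hxy)
  · intro ψ v
    simpa [hπapp] using hpos ψ v

/-- **The layer telescope.**  If `0 ≤ T m + (B (m + 1) - B m)` for all `m < n` and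
`B 0 = 0 = B n`, then `0 ≤ Σ_{m < n} T m` (the transfer terms telescope away). [folklore] -/
theorem sum_nonneg_of_telescope (n : ℕ) (T B : ℕ → ℝ) (h0 : B 0 = 0) (hn : B n = 0)
    (h : ∀ m < n, 0 ≤ T m + (B (m + 1) - B m)) : 0 ≤ ∑ m ∈ Finset.range n, T m := by
  have h1 : 0 ≤ ∑ m ∈ Finset.range n, (T m + (B (m + 1) - B m)) :=
    Finset.sum_nonneg fun m hm => h m (Finset.mem_range.1 hm)
  rw [Finset.sum_add_distrib, Finset.sum_range_sub, hn, h0, sub_zero, add_zero] at h1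
  exact h1

end Summit.AtomisticToContinuum.Crystallization.Theorems.PricedLinkCensusTruncatedCensusGap

end
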